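import Summits.Ventures.HSemireg.WedgeHankelRecurrenceGaussChebyshevSineProductHalf

/-!
# Venture HSemireg — **THE QUARTER-ANGLE PRODUCTS FROM `C_n(±2) = ±2`: `∏_{j<n} (2 − 2cos((2j+1)π∕2n)) = 2`, `∏_{j<n} (2 + 2cos((2j+1)π∕2n)) = 2`, hence
# `∏_{j<n} 2sin((2j+1)π∕4n) = ∏_{j<n} 2cos((2j+1)π∕4n) = √2`, i.e. `∏_{k=1}^{n} sin((2k−1)π∕4n) = ∏_{k=1}^{n} cos((2k−1)π∕4n) = √2 ∕ 2ⁿ`** (`n ≥ 1`) — by evaluating the real factorisation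
# `C_n = ∏_{j<n} (X − 2cos((2j+1)π∕2n))` (N500) at `X = 2` (`C_n(2) = 2`) and reflecting `j ↦ n − 1 − j`

HONEST FRAMING. Part of the Lean index of the computation cell `pub-hsemireg` (seat p10 gen 49, Sunday typer «UNIFORM-IN-n»).  Real polynomial evaluation and trigonometry only (Mathlib
`Polynomial.Chebyshev.C`, `Real.sin ∕ cos ∕ sqrt`); no variety, no cohomology theory, no sheaf, no Ext group and no semiregularity map is constructed here; nothing here says that HC / HC_CM / HC_AV
holds; no Literature fact (unproved `Prop`) is declared or used.  Custodian versions as in `WedgeHankelSiegelIdeal` (1/3).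
SOURCES (cited).  I. S. Gradshteyn, I. M. Ryzhik, *Table of Integrals, Series, and Products*, 1.392 (`∏_{k=1}^{n} sin((2k−1)π∕4n) = ∏_{k=1}^{n} cos((2k−1)π∕4n) = √2∕2ⁿ`); T. J. Rivlin, *The Chebyshev
Polynomials* (1974), §1.2 (`T_n(1) = 1`); J. C. Mason, D. C. Handscomb, *Chebyshev Polynomials* (2003), §2.4.
PROOF TYPED HERE.  N500 `chebyshevC_eq_prod_real` at `X = 2` with Mathlib `C_eval_two`; reflection `j ↦ n − 1 − j` (`cos(π − θ) = −cos θ`, `Finset.prod_range_reflect`); `2 ∓ 2cos 2α = 4sin² α ∕ 4cos² α`;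
positivity on `(0, π∕2)`; `Real.sqrt_sq`.
DEDUP DISCLOSURE (`rg -n 'prod_sin|prod_cos|quarter' Summits Literature`, `lean search`, 2026-09-04): N510 ∕ N511 have the `πj∕n` and `πj∕2n` products; the odd-multiple quarter-angle products
below are in neither Mathlib nor the tree; 0 hits for the 9 names below.

WHAT IS IN THE TREE.  N500 `chebyshevC_eq_prod_real`; N511 (method, `angle_quarter_mem`); Mathlib `C_eval_two`, `Real.cos_pi_sub`, `Real.cos_two_mul`, `Real.cos_sq'`, `Real.sqrt_sq`.
THIS FILE (namespace `Summit.Ventures.HSemireg.Wedge.HankelOuter` continued; CHAINED on N511; 0 definitions):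
* §1277 **`prod_two_sub_two_mul_cos_odd_eq_two`**, **`prod_two_add_two_mul_cos_odd_eq_two`**, `prod_four_mul_sin_sq_quarter_eq_two`, `prod_four_mul_cos_sq_quarter_eq_two`, `angle_eighth_mem`,
  **`prod_two_mul_sin_quarter_eq_sqrt_two`**, **`prod_two_mul_cos_quarter_eq_sqrt_two`**, **`prod_sin_odd_pi_div_four_mul_eq`**, **`prod_cos_odd_pi_div_four_mul_eq`**.
CAVEATS.  `n ≥ 1`.  Nothing Ext-side.  New names only.
-/

open Module Polynomial
open scoped Matrix Polynomial

namespace Summit.Ventures.HSemireg.Wedge.HankelOuter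

/-! ## §1277. Quarter-angle sine and cosine products -/

/-- **`∏_{j<n} (2 − 2cos((2j+1)π∕2n)) = 2`** (`n ≥ 1`; `= C_n(2)`). [Rivlin §1.2 (`T_n(1) = 1`); this file, §1277] -/
theorem prod_two_sub_two_mul_cos_odd_eq_two {n : ℕ} (hn : n ≠ 0) : ∏ j ∈ Finset.range n, (2 - 2 * Real.cos ((2 * j + 1) * Real.pi / (2 * n))) = (2 : ℝ) := by
  have h := congrArg (Polynomial.eval (2 : ℝ)) (chebyshevC_eq_prod_real hn)
  rw [Polynomial.Chebyshev.C_eval_two, eval_prod] at h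
  refine Eq.trans (Finset.prod_congr rfl fun j _ => ?_) h.symm
  rw [eval_sub, eval_X, eval_C]

/-- **`∏_{j<n} (2 + 2cos((2j+1)π∕2n)) = 2`** (`n ≥ 1`; reflection `j ↦ n − 1 − j`). [Rivlin §1.2; this file, §1277] -/
theorem prod_two_add_two_mul_cos_odd_eq_two {n : ℕ} (hn : n ≠ 0) : ∏ j ∈ Finset.range n, (2 + 2 * Real.cos ((2 * j + 1) * Real.pi / (2 * n))) = (2 : ℝ) := by
  rw [← Finset.prod_range_reflect (fun j => 2 + 2 * Real.cos ((2 * j + 1) * Real.pi / (2 * n))) n]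
  refine Eq.trans (Finset.prod_congr rfl fun j hj => ?_) (prod_two_sub_two_mul_cos_odd_eq_two hn)
  have hj := Finset.mem_range.mp hj
  have hnR : (n : ℝ) ≠ 0 := by exact_mod_cast hn
  have hidx : (2 * ((n - 1 - j : ℕ) : ℝ) + 1) * Real.pi / (2 * n) = Real.pi - (2 * (j : ℝ) + 1) * Real.pi / (2 * n) := by
    rw [Nat.cast_sub (by omega), Nat.cast_sub (Nat.one_le_iff_ne_zero.mpr hn), Nat.cast_one]
    field_simp
    ring
  simp only [hidx, Real.cos_pi_sub]
  ring

/-- `∏_{j<n} 4sin²((2j+1)π∕4n) = 2` (`n ≥ 1`). [Gradshteyn–Ryzhik 1.392; this file, §1277] -/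
theorem prod_four_mul_sin_sq_quarter_eq_two {n : ℕ} (hn : n ≠ 0) : ∏ j ∈ Finset.range n, 4 * Real.sin ((2 * j + 1) * Real.pi / (4 * n)) ^ 2 = (2 : ℝ) := by
  refine Eq.trans (Finset.prod_congr rfl fun j _ => ?_) (prod_two_sub_two_mul_cos_odd_eq_two hn)
  have hθ : (2 * (j : ℝ) + 1) * Real.pi / (2 * n) = 2 * ((2 * (j : ℝ) + 1) * Real.pi / (4 * n)) := by
    have hnR : (n : ℝ) ≠ 0 := by exact_mod_cast hn
    field_simp
    ring
  rw [hθ, Real.cos_two_mul, Real.cos_sq']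
  ring

/-- `∏_{j<n} 4cos²((2j+1)π∕4n) = 2` (`n ≥ 1`). [Gradshteyn–Ryzhik 1.392; this file, §1277] -/
theorem prod_four_mul_cos_sq_quarter_eq_two {n : ℕ} (hn : n ≠ 0) : ∏ j ∈ Finset.range n, 4 * Real.cos ((2 * j + 1) * Real.pi / (4 * n)) ^ 2 = (2 : ℝ) := by
  refine Eq.trans (Finset.prod_congr rfl fun j _ => ?_) (prod_two_add_two_mul_cos_odd_eq_two hn)
  have hθ : (2 * (j : ℝ) + 1) * Real.pi / (2 * n) = 2 * ((2 * (j : ℝ) + 1) * Real.pi / (4 * n)) := by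
    have hnR : (n : ℝ) ≠ 0 := by exact_mod_cast hn
    field_simp
    ring
  rw [hθ, Real.cos_two_mul]
  ring

/-- The angles `(2j+1)π∕4n`, `j < n`, lie in `(0, π∕2)`. [bookkeeping; this file, §1277] -/
theorem angle_eighth_mem {j n : ℕ} (hj : j < n) : 0 < (2 * (j : ℝ) + 1) * Real.pi / (4 * n) ∧ (2 * (j : ℝ) + 1) * Real.pi / (4 * n) < Real.pi / 2 := by
  have hnR : (0 : ℝ) < n := by exact_mod_cast (Nat.zero_le j).trans_lt hj
  refine ⟨by positivity, ?_⟩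
  rw [div_lt_div_iff₀ (by positivity) two_pos]
  have : (j : ℝ) + 1 ≤ n := by exact_mod_cast Nat.lt_iff_add_one_le.mp hj
  nlinarith [Real.pi_pos]

/-- **`∏_{j<n} 2sin((2j+1)π∕4n) = √2`** (`n ≥ 1`). [Gradshteyn–Ryzhik 1.392; this file, §1277] -/
theorem prod_two_mul_sin_quarter_eq_sqrt_two {n : ℕ} (hn : n ≠ 0) : ∏ j ∈ Finset.range n, 2 * Real.sin ((2 * j + 1) * Real.pi / (4 * n)) = Real.sqrt 2 := by
  have hnonneg : 0 ≤ ∏ j ∈ Finset.range n, 2 * Real.sin ((2 * j + 1) * Real.pi / (4 * n)) :=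
    Finset.prod_nonneg fun j hj => mul_nonneg zero_le_two
      (Real.sin_pos_of_pos_of_lt_pi (angle_eighth_mem (Finset.mem_range.mp hj)).1 ((angle_eighth_mem (Finset.mem_range.mp hj)).2.trans (by linarith [Real.pi_pos]))).le
  have hsq : (∏ j ∈ Finset.range n, 2 * Real.sin ((2 * j + 1) * Real.pi / (4 * n))) ^ 2 = 2 := by
    rw [← Finset.prod_pow]
    exact Eq.trans (Finset.prod_congr rfl fun j _ => by ring) (prod_four_mul_sin_sq_quarter_eq_two hn)
  have h := Real.sqrt_sq hnonneg
  rw [hsq] at h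
  exact h.symm

/-- **`∏_{j<n} 2cos((2j+1)π∕4n) = √2`** (`n ≥ 1`). [Gradshteyn–Ryzhik 1.392; this file, §1277] -/
theorem prod_two_mul_cos_quarter_eq_sqrt_two {n : ℕ} (hn : n ≠ 0) : ∏ j ∈ Finset.range n, 2 * Real.cos ((2 * j + 1) * Real.pi / (4 * n)) = Real.sqrt 2 := by
  have hnonneg : 0 ≤ ∏ j ∈ Finset.range n, 2 * Real.cos ((2 * j + 1) * Real.pi / (4 * n)) :=
    Finset.prod_nonneg fun j hj => mul_nonneg zero_le_two
      (Real.cos_pos_of_mem_Ioo ⟨by linarith [(angle_eighth_mem (Finset.mem_range.mp hj)).1, Real.pi_pos], (angle_eighth_mem (Finset.mem_range.mp hj)).2⟩).le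
  have hsq : (∏ j ∈ Finset.range n, 2 * Real.cos ((2 * j + 1) * Real.pi / (4 * n))) ^ 2 = 2 := by
    rw [← Finset.prod_pow]
    exact Eq.trans (Finset.prod_congr rfl fun j _ => by ring) (prod_four_mul_cos_sq_quarter_eq_two hn)
  have h := Real.sqrt_sq hnonneg
  rw [hsq] at h
  exact h.symm

/-- **`∏_{j<n} sin((2j+1)π∕4n) = √2 ∕ 2ⁿ`** (`n ≥ 1`). [Gradshteyn–Ryzhik 1.392; this file, §1277] -/
theorem prod_sin_odd_pi_div_four_mul_eq {n : ℕ} (hn : n ≠ 0) : ∏ j ∈ Finset.range n, Real.sin ((2 * j + 1) * Real.pi / (4 * n)) = Real.sqrt 2 / 2 ^ n := by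
  have h := prod_two_mul_sin_quarter_eq_sqrt_two hn
  rw [Finset.prod_mul_distrib, Finset.prod_const, Finset.card_range] at h
  rw [eq_div_iff (pow_ne_zero _ two_ne_zero), mul_comm]
  exact h

/-- **`∏_{j<n} cos((2j+1)π∕4n) = √2 ∕ 2ⁿ`** (`n ≥ 1`). [Gradshteyn–Ryzhik 1.392; this file, §1277] -/
theorem prod_cos_odd_pi_div_four_mul_eq {n : ℕ} (hn : n ≠ 0) : ∏ j ∈ Finset.range n, Real.cos ((2 * j + 1) * Real.pi / (4 * n)) = Real.sqrt 2 / 2 ^ n := by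
  have h := prod_two_mul_cos_quarter_eq_sqrt_two hn
  rw [Finset.prod_mul_distrib, Finset.prod_const, Finset.card_range] at h
  rw [eq_div_iff (pow_ne_zero _ two_ne_zero), mul_comm]
  exact h

end Summit.Ventures.HSemireg.Wedge.HankelOuter
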